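import Summits.QuantumFields.YangMills.Theorems.PencilRigidityHypercubicLimitDefs
import HarnessLib

/-!
# Crux `HypercubicLimit` (stmt-QuantumFields-8646), line `conditional-mean-telescoping`: vocabulary B (reshape 3, c2 seat)

Second route-posited vocabulary file of the line (D-0016 `<Route><Crux>Defs` class; companion of
`PencilRigidityHypercubicLimitDefs.lean`, p96726), shared by the registered stubs of the reshape-3 skeleton
`Cruxes/HypercubicLimit/Lines/conditional-mean-telescoping.lean` (c2 seat, 2026-08-16) and the Theorems files that
land them.  NOTHING here is asserted: every `def … : Prop` is a statement a registered stub proves or consumes.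

* §5b `ScaledShiftedBound` — the abstract analytic core of the closure's leg (U): the a-uniform bound for SCALED
  weights (sup bound `Mⁿ`, separated bound of Gaussian-domination shape `(B (R₀/R)^P)ⁿ`) against `⁰𝒮` test functions
  at shifted evaluation points (c2 sub-goal `stub_scaledShiftedBound`; consumed by `uniformBound_of_scaledShiftedBound`).
* §7b the closure interface with the c1 seat's renormalisation clause (`CONSULT-c1-softdata.md`): `PolyRenorm`
  (`c_k ≤ a_k^{-Q}`), `SoftLegsP` (= `SoftLegs` ∧ `PolyRenorm` for the same witness, registered stub `stub_softLegs`),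
  `ReflectionLegsP` (= `ReflectionLegs` consuming `PolyRenorm`, registered stub `stub_reflectionLegs`), and the
  pure-logic reassembly `oneFieldLimit_of_legsP : LatticeGapInput → SoftLegsP → ReflectionLegsP → OneFieldLimit`.

Refs: `PencilRigidityHypercubicLimitDefs.lean` §7; line card `Cruxes/HypercubicLimit/Lines/conditional-mean-telescoping.md`;
OsterwalderSchrader1975 §2 (E0′, `⁰𝒮`); GlimmJaffe1987 §6.1.
-/

set_option autoImplicit false

noncomputable section

open scoped SchwartzMap ENNReal
open MeasureTheory Filter Topology
open Literature.MathematicalPhysics.AQFT Literature.MathematicalPhysics.QuantumLattice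
open Literature.MathematicalPhysics.QuantumFieldTheory
open Literature.Probability.LatticeModels (box Site)

namespace Summit.QuantumFields.YangMills.Cruxes.HypercubicLimit.ConditionalMeanTelescoping

local notation "E4" => EuclideanSpace ℝ (Fin 4)
local notation "Zd4" => Literature.Probability.LatticeModels.Site 4

/-! ## 5b. (U) cut in two: the abstract scaled a-uniform bound, and its instantiation -/

/-- **Scaled shifted bound** (abstract analytic core of (U), c2 seat): for weights `W` on `n`-tuples of sites with
a sup bound `Mⁿ` and a SEPARATED bound of Gaussian-domination shape `(B (R₀/R)^P)ⁿ` (every pair more than `2R+1`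
and at most `L` apart in some coordinate, `1 ≤ R ≤ R₀`, `R₀ a ≤ δ`), for `F ∈ ⁰𝒮ₙ` evaluated at points within `6a`
of the scaled sites: `a⁴ⁿ ‖Σₓ W(x) F(y(x))‖ ≤ Kⁿ (Bⁿ + Mⁿ a^{En}) ‖F‖_{s n}`, ONE `K, s` depending on `(δ, P, E)`
only (three zones: outer — Schwartz decay beyond `1/(6a)`; near-diagonal — flat decay of order `En`; separated —
flat decay of order `Pn` against `(R₀/R)^P ≤ (4δ/(a ρ))^P`; summed by `Σₓ ∏ₗ a⁴(1 + a‖xₗ‖)⁻⁶ ≤ Cⁿ`). -/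
def ScaledShiftedBound : Prop :=
  ∀ δ : ℝ, 0 < δ → ∀ P E : ℕ, ∃ (K : ℝ) (s : ℕ), 0 ≤ K ∧
    ∀ n : ℕ, 2 ≤ n → ∀ (L R₀ : ℕ) (a M B : ℝ) (W : (Fin n → Zd4) → ℝ)
      (y : (Fin n → Zd4) → (Fin n → E4)) (F : 𝓢((Fin n → E4), ℂ)),
      0 < a → a ≤ 1 / 24 → a⁻¹ * a⁻¹ ≤ (L : ℝ) → 1 ≤ R₀ → (R₀ : ℝ) * a ≤ δ → 4 * R₀ + 4 < 2 * L + 1 →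
      0 ≤ M → 0 ≤ B → (∀ x, |W x| ≤ M ^ n) →
      (∀ x ∈ Fintype.piFinset (fun _ : Fin n => box 4 L), ∀ R : ℕ, 1 ≤ R → R ≤ R₀ →
        (∀ k l : Fin n, k ≠ l → ∃ μ : Fin 4, (2 * R + 1 : ℤ) < |x k μ - x l μ| ∧ |x k μ - x l μ| ≤ L) →
          |W x| ≤ (B * ((R₀ : ℝ) / R) ^ P) ^ n) →
      (∀ x l, ‖y x l - a • siteToE (x l)‖ ≤ 6 * a) → IsOffDiagonal F →
        a ^ (4 * n) * ‖∑ x ∈ Fintype.piFinset (fun _ : Fin n => box 4 L), ((W x : ℝ) : ℂ) * F (y x)‖ ≤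
          K ^ n * (B ^ n + M ^ n * a ^ (E * n)) * schwartzNorm (s * n) F

/-! ## 7b. The closure interface with c1's renormalisation clause -/

section Interface

variable {G : Type} [Group G] [TopologicalSpace G] [IsTopologicalGroup G] [CompactSpace G]
  [MeasurableSpace G] [BorelSpace G]

/-- **c1's clause** (CONSULT-c1-softdata.md): the multiplicative renormalisation of the curvature is polynomial in
`1/a_k` along the scheme (from (W2)(a),(c): `refSquare ≥ C⁻¹ (a/δ₀)^p · m(β)^q`). -/
def PolyRenorm (r : LatticeRep G) (sch : SpeciesScheme (YMSpecies G)) : Prop :=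
  ∃ Q : ℕ, ∀ k, sch.c r.curvature k ≤ ((sch.a k)⁻¹) ^ Q

end Interface

/-- **(S) Soft legs, with the renormalisation clause**: `SoftLegs` ∧ `PolyRenorm` for the same witness. -/
def SoftLegsP : Prop :=
  ∀ (G : Type) [Group G] [TopologicalSpace G] [IsTopologicalGroup G] [CompactSpace G]
    [MeasurableSpace G] [BorelSpace G], IsCompactSimpleLieGroup G →
    ∀ (r : LatticeRep G) (β₁ C₁ c₂ : ℝ) (m : ℝ → ℝ), GapData G r β₁ C₁ c₂ m →
      ∀ Λ : ℝ → ℕ → ℕ, ∃ (δ₀ : ℝ) (sch : SpeciesScheme (YMSpecies G)) (S₁ : SchwingerFamily E4)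
        (Spl : (n : ℕ) → (Fin n → Fin 4 × Fin 4) → (𝓢((Fin n → E4), ℂ) →L[ℂ] ℂ)),
        0 < δ₀ ∧ SoftData r m δ₀ Λ sch S₁ Spl ∧ PolyRenorm r sch ∧ SoftClauses r sch S₁

/-- **(R) Reflection legs, consuming the renormalisation clause** (c1 seat): for every `(G, r)` with gap data
there is a torus demand `Λ` such that every `SoftData` witness obeying it AND `PolyRenorm` satisfies `ReflClauses`. -/
def ReflectionLegsP : Prop :=
  ∀ (G : Type) [Group G] [TopologicalSpace G] [IsTopologicalGroup G] [CompactSpace G]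
    [MeasurableSpace G] [BorelSpace G], IsCompactSimpleLieGroup G →
    ∀ (r : LatticeRep G) (β₁ C₁ c₂ : ℝ) (m : ℝ → ℝ), GapData G r β₁ C₁ c₂ m →
      ∃ Λ : ℝ → ℕ → ℕ, ∀ (δ₀ : ℝ) (sch : SpeciesScheme (YMSpecies G)) (S₁ : SchwingerFamily E4)
        (Spl : (n : ℕ) → (Fin n → Fin 4 × Fin 4) → (𝓢((Fin n → E4), ℂ) →L[ℂ] ℂ)),
        0 < δ₀ → SoftData r m δ₀ Λ sch S₁ Spl → PolyRenorm r sch → ReflClauses S₁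

/-- **The closure, reassembled (pure logic)**, with the renormalisation clause threaded from (S) to (R). -/
theorem oneFieldLimit_of_legsP : LatticeGapInput → SoftLegsP → ReflectionLegsP → OneFieldLimit := by
  intro hL hS hR G _ _ _ _ hG
  letI : MeasurableSpace G := borel G
  haveI : BorelSpace G := ⟨rfl⟩
  obtain ⟨r, β₁, C₁, c₂, m, hgap⟩ := hL G hG
  obtain ⟨Λ, hΛ⟩ := hR G hG r β₁ C₁ c₂ m hgap
  obtain ⟨δ₀, sch, S₁, Spl, hδ₀, hD, hP, hE0, hE0', hE3, htr, hconv, hNT, hNG, hlat⟩ :=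
    hS G hG r β₁ C₁ c₂ m hgap Λ
  obtain ⟨hherm, hRP, hcl, hhyp, hgap1⟩ := hΛ δ₀ sch S₁ Spl hδ₀ hD hP
  exact ⟨r, sch, S₁, ⟨hE0, hherm, hE0', hRP, hE3, hcl, htr, hhyp⟩, hconv, hNT, hNG, 1, one_pos, hgap1, hlat⟩

end Summit.QuantumFields.YangMills.Cruxes.HypercubicLimit.ConditionalMeanTelescoping

end
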